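import Literature.MathematicalPhysics.QuantumFieldTheory.Balaban1983to89.B8Eq1101DentedCubeMemberCommutator
import Literature.MathematicalPhysics.QuantumFieldTheory.Balaban1983to89.B8Eq1101CubeMemberRealM4

/-!
# `Balaban1983to89.B8Eq1101DentedCubeMemberRegionA4` — [Balaban1985BackgroundPropagators] (3.47) AT `γ = −4` ON THE DENTED CUBE MEMBER `{Ω′_j}` OF [Balaban1985Variational]
# (148)–(150): REGION A AT EXPONENT 4 AND THE VANISHING OF THE COMMUTATOR ON `□₂` — dented twins of dag-n05-c's F4e `B8Eq1101CubeMemberRealM4` §§2–3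

statement-level skeleton of published theorems with citation tags; proofs where landed; nothing here is a claim about the Yang–Mills mass gap

`[Balaban1985RegularSpaces]` ("B8" = [6], CMP **99** (1985) 75–102) (1.101) p. 93, p. 98, (1.131) p. 99; `[Balaban1985BackgroundPropagators]` ([4], CMP **99** (1985) 389–434)
Theorem 3.1 (3.47) p. 398; `[Balaban1984PropagatorsII]` ("B6", CMP **96** (1984) 223–250) (2.48) p. 231, (2.52)–(2.55) p. 232–233, Prop. 2.2 (2.67) p. 234;
`[Balaban1985Variational]` ("[15]", CMP **102** (1985) 277–309) (148)–(151) p. 301.  PDFs held (`paper:balaban1985-cmp99-…`, `…-cmp102-…`, `…-cmp96-…`).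
CITATION HEADER (lean-in-tree rule).  Cell `pub-ymgap` (D-0062), node N05 = [B8], seat `pub-ymgap-dag-n05-e` (g32; row s3b; (d2-f) the dented parametrix, file 6; g31 HANDOFF
«Next 1 (iii)», dag-n05-c STANDING GO I.42366, INTENT I.43617).  WHY: the two lemmas of F4e that the exponent-`4` transfer (next file) consumes, re-read on NODE 00's dented
datum `c : CubeB8D` (tower `c.sq`, cells `c.lamS`, level function `levD`).  WHAT (kernel-checked): §2 `regionA_bounds4` (the `(Lʲη)⁴`-bounded source truncated to region A obeys
r05's `(L^{levD})^{−4}` hypothesis; output `η⁴(L^{levD})²|G′u_A| ≤ C′N`), §3 `commutator_vanish_deep` (for `x ∈ □₂` every entry of the commutator row vanishes — `k ≥ 2`,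
`4s + (d+1)ℓ ≤ ρL`).  HONEST SCOPE: bookkeeping and an elementary vanishing; no estimate of [4]∕[6]; count-neutral; N05 ∕ N07 NOT discharged; one finite `T⁴` programme at fixed
`ε`, Bałaban as printed; nothing continuum ∕ ℝ⁴ ∕ OS ∕ mass-gap ∕ Clay.  No `sorry`∕`def`∕`instance`∕`notation`.  RELATED, NOT DUPLICATED (`rg -l 'Eq1101DentedCubeMemberRegionA4'`
= 0, 2026-08-28T23:10Z): F4e (dag-n05-c; the PURE twin), `B8DentedCubeMemberBoxTowers` (g32), F4a∕F4b structure-free lemmas (USED).  Unit `pub-ymgap-dag-n05-e` (g32), 2026-08-28.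
-/
noncomputable section

namespace Literature.MathematicalPhysics.QuantumFieldTheory.Balaban1983to89.B8Eq1101DentedCubeMemberRegionA4

open scoped Matrix
open B6MultiLevelBoxOperator (N0 mlOp gml levC)
open B4Reflection242 (boxDom mem_boxDom blk)
open B7Prop1Explicit (e)
open B8Eq131Cubes (l1dist cube cube_anti)
open B8Eq191FlatDirichletDepth (depth depth_ge_of_mem_inner)
open B8CubeMemberBoxDomains (shift boxP)
open B8CubeMemberTorusDomainsDented (levD levD_le)
open B8DentedCubeMemberBoxTowers (tower_iff_levD_eq mem_sq_of_tower mem_cube_of_tower)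
open B8Eq1101CubeMemberCutoffs (cutA cutAt cutB cutBt cut_mem cutAt_eq_of_depth cutBt_facts abs_depth_sub_le_l1dist l1dist_le_of_blockMap_eq
  blockMap_pow_zero)
open B8Eq1101CubeMemberParametrixIdentity (mem_cube_one_of_cutA_ne_zero)
open B8Eq191FlatDirichletWall (abs_l1dist_step_le l1dist_self l1dist_nonneg)
open Node00 (CubeB8D)
open Literature.MathematicalPhysics.QuantumLattice (blockMap)

variable {d : ℕ}

/-! ## §2 Region A input∕output at exponent 4 on the dented tower -/

open Classical in
/-- **REGION A AT EXPONENT 4.**  For a source `u` with `(Lʲη)⁴|u| ≤ N` on `□_j` (`j ≤ n`), the truncated and translated source `u_A(y) = h_A(y − t)u(y − t)` on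
p21's box satisfies `|u_A(y)| ≤ Nη⁻⁴(L^{lev y})⁻⁴`, hence region A's output obeys `η⁴(L^{lev y})²|(G′u_A)(y)| ≤ C′N` (the `(−4) → (−2)` mapping of (3.47)).
[cite: Balaban1985RegularSpaces, (1.101) p.93, p.98; Balaban1985BackgroundPropagators, (3.47) p.398; Balaban1984PropagatorsII, Prop. 2.2 (2.67) p.234] -/
theorem regionA_bounds4 {ℓ Mh K' : ℕ} {Ω : ℕ → Set (Fin (d + 1) → ℤ)} (c : CubeB8D (d + 1) (ℓ + 1) K' Ω)
    {η : ℝ} (hη : 0 < η) (aw : ℕ → ℝ) {C' : ℝ}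
    (hG : ∀ (f : ↥(boxDom (N0 ℓ Mh c.k (boxP ℓ c.M c.ρ c.k c.k))) → ℝ) (S' : ℝ), 0 ≤ S' →
      (∀ z : ↥(boxDom (N0 ℓ Mh c.k (boxP ℓ c.M c.ρ c.k c.k))), |f z| ≤ S' * ((((ℓ : ℝ) + 1) ^ levD Mh c z.1) ^ 4)⁻¹) →
      ∀ y : ↥(boxDom (N0 ℓ Mh c.k (boxP ℓ c.M c.ρ c.k c.k))),
        |(gml (N0 ℓ Mh c.k (boxP ℓ c.M c.ρ c.k c.k)) ℓ c.k (levD Mh c) aw *ᵥ f) y| ≤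
          C' * (((ℓ : ℝ) + 1) ^ levD Mh c y.1) ^ 2 * ((((ℓ : ℝ) + 1) ^ levD Mh c y.1) ^ 4)⁻¹ * S')
    {s : ℕ} (hs : 1 ≤ s) (u : (Fin (d + 1) → ℤ) → ℝ) {N : ℝ} (hN : 0 ≤ N)
    (hu : ∀ j, j ≤ c.k → ∀ z, z ∈ c.sq j → ((((ℓ + 1 : ℕ) : ℝ)) ^ j * η) ^ 4 * |u z| ≤ N)
    (uA : ↥(boxDom (N0 ℓ Mh c.k (boxP ℓ c.M c.ρ c.k c.k))) → ℝ)
    (huA : ∀ y, uA y = cutA (Nat.succ_pos d) (ℓ + 1) c.a c.M c.ρ c.k s (y.1 - shift ℓ Mh c.a c.ρ c.k c.k) * u (y.1 - shift ℓ Mh c.a c.ρ c.k c.k))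
    (y : ↥(boxDom (N0 ℓ Mh c.k (boxP ℓ c.M c.ρ c.k c.k)))) :
    η ^ 4 * (((ℓ : ℝ) + 1) ^ levD Mh c y.1) ^ 2 * |(gml (N0 ℓ Mh c.k (boxP ℓ c.M c.ρ c.k c.k)) ℓ c.k (levD Mh c) aw *ᵥ uA) y|
      ≤ C' * N := by
  have hk : 1 ≤ c.k := c.one_le_k
  have hη4 : 0 < η ^ 4 := by positivity
  have hcast : ((ℓ + 1 : ℕ) : ℝ) = (ℓ : ℝ) + 1 := by push_cast; ring
  have hL0 : (0 : ℝ) < (ℓ : ℝ) + 1 := by positivity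
  -- the input bound
  have huA' : ∀ z : ↥(boxDom (N0 ℓ Mh c.k (boxP ℓ c.M c.ρ c.k c.k))),
      |uA z| ≤ N * (η ^ 4)⁻¹ * ((((ℓ : ℝ) + 1) ^ levD Mh c z.1) ^ 4)⁻¹ := by
    intro z
    rw [huA z]
    by_cases h0 : cutA (Nat.succ_pos d) (ℓ + 1) c.a c.M c.ρ c.k s (z.1 - shift ℓ Mh c.a c.ρ c.k c.k) = 0
    · rw [h0, zero_mul, abs_zero]; positivity
    · have hz1 := mem_cube_one_of_cutA_ne_zero (Nat.succ_pos d) (ℓ + 1) c.a c.M c.ρ hs hk h0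
      have hz0 : z.1 - shift ℓ Mh c.a c.ρ c.k c.k ∈ cube (ℓ + 1) c.a c.M c.ρ c.k 0 := cube_anti (Nat.zero_le 1) hk hz1
      set j₀ := levD Mh c z.1 with hj₀
      have hj₀n : j₀ ≤ c.k := levD_le Mh c _
      have hzt : z.1 - shift ℓ Mh c.a c.ρ c.k c.k + shift ℓ Mh c.a c.ρ c.k c.k = z.1 := sub_add_cancel _ _
      have htower : blockMap ((ℓ + 1) ^ j₀) (z.1 - shift ℓ Mh c.a c.ρ c.k c.k) ∈ c.lamS j₀ := by
        rw [tower_iff_levD_eq c hj₀n hz0 (Mh := Mh), hzt]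
      have hzj : z.1 - shift ℓ Mh c.a c.ρ c.k c.k ∈ c.sq j₀ := mem_sq_of_tower c hj₀n htower
      have hb := hu j₀ hj₀n _ hzj
      rw [hcast] at hb
      have hc := (cut_mem (Nat.succ_pos d) (ℓ + 1) c.a c.M c.ρ c.k s (z.1 - shift ℓ Mh c.a c.ρ c.k c.k)).1
      rw [abs_mul, abs_of_nonneg hc.1]
      have hpow : 0 < (((ℓ : ℝ) + 1) ^ j₀) ^ 4 := by positivity
      calc cutA (Nat.succ_pos d) (ℓ + 1) c.a c.M c.ρ c.k s (z.1 - shift ℓ Mh c.a c.ρ c.k c.k) * |u (z.1 - shift ℓ Mh c.a c.ρ c.k c.k)|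
          ≤ 1 * |u (z.1 - shift ℓ Mh c.a c.ρ c.k c.k)| := mul_le_mul_of_nonneg_right hc.2 (abs_nonneg _)
        _ ≤ N * (η ^ 4)⁻¹ * ((((ℓ : ℝ) + 1) ^ j₀) ^ 4)⁻¹ := by
            rw [one_mul, mul_assoc, ← mul_inv, le_mul_inv_iff₀ (by positivity)]
            calc |u (z.1 - shift ℓ Mh c.a c.ρ c.k c.k)| * (η ^ 4 * (((ℓ : ℝ) + 1) ^ j₀) ^ 4)
                = (((ℓ : ℝ) + 1) ^ j₀ * η) ^ 4 * |u (z.1 - shift ℓ Mh c.a c.ρ c.k c.k)| := by ring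
              _ ≤ N := hb
  have h1 := hG uA (N * (η ^ 4)⁻¹) (by positivity) huA' y
  set lam : ℝ := ((ℓ : ℝ) + 1) ^ levD Mh c y.1 with hlam
  have hlam0 : 0 < lam := by rw [hlam]; positivity
  calc η ^ 4 * lam ^ 2 * |(gml (N0 ℓ Mh c.k (boxP ℓ c.M c.ρ c.k c.k)) ℓ c.k (levD Mh c) aw *ᵥ uA) y|
      ≤ η ^ 4 * lam ^ 2 * (C' * lam ^ 2 * (lam ^ 4)⁻¹ * (N * (η ^ 4)⁻¹)) := mul_le_mul_of_nonneg_left h1 (by positivity)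
    _ = C' * N := by field_simp

/-! ## §3 The commutator vanishes on `□₂` -/

open Classical in
/-- **THE COMMUTATOR ROW VANISHES AT THE SITES OF `□₂`** (`4s + (d+1)ℓ ≤ ρL`, `k ≥ 2`): for `x ∈ □₂` every entry `K(x,z)` of the row meets a vanishing
difference of cutoffs — the site, its lattice neighbours and its tower block (of level `J ≥ 2`, inside `□_J ⊂ □₂`; of level `1`, within `|·|₁`-distance `(d+1)ℓ`)
are all at depth `≥ 4s` into `□₁`, where `h̃_A ≡ 1` and `h̃_B ≡ 0`.
[cite: Balaban1984PropagatorsII, (2.52)–(2.55) p.232–233, (2.48) p.231; Balaban1985RegularSpaces, (1.101) p.93, (1.131) p.99] -/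
theorem commutator_vanish_deep {ℓ K' : ℕ} {Ω : ℕ → Set (Fin (d + 1) → ℤ)} (c : CubeB8D (d + 1) (ℓ + 1) K' Ω) (hk2 : 2 ≤ c.k)
    {η : ℝ} (w : ℕ → ℝ) (K : (Fin (d + 1) → ℤ) → (Fin (d + 1) → ℤ) → ℝ)
    (hK : ∀ x z, K x z = ((η ^ 2)⁻¹ * ∑ μ : Fin (d + 1), ((2 : ℝ) * (if z = x then (1 : ℝ) else 0) - (if z = x + e μ then (1 : ℝ) else 0)
        - (if z = x - e μ then (1 : ℝ) else 0))) +
        (∑ j ∈ Finset.range (c.k + 1), (if blockMap ((ℓ + 1) ^ j) x ∈ c.lamS j ∧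
            blockMap ((ℓ + 1) ^ j) z = blockMap ((ℓ + 1) ^ j) x then
          w j * (((((ℓ + 1 : ℕ) : ℝ) ^ (d + 1))⁻¹) ^ j) ^ 2 else 0)))
    (S : Finset (Fin (d + 1) → ℤ))
    {s : ℕ} (hs : 1 ≤ s) (hs4 : 4 * s + (d + 1) * ℓ ≤ c.ρ * (ℓ + 1))
    (gAx gBx : (Fin (d + 1) → ℤ) → ℝ) {x : Fin (d + 1) → ℤ} (hx2 : x ∈ cube (ℓ + 1) c.a c.M c.ρ c.k 2) :
    ∑ z ∈ S, K x z * ((cutAt (Nat.succ_pos d) (ℓ + 1) c.a c.M c.ρ c.k s z - cutAt (Nat.succ_pos d) (ℓ + 1) c.a c.M c.ρ c.k s x) * (η ^ 2 * gAx z)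
        + (cutBt (Nat.succ_pos d) (ℓ + 1) c.a c.M c.ρ c.k s z - cutBt (Nat.succ_pos d) (ℓ + 1) c.a c.M c.ρ c.k s x) * gBx z) = 0 := by
  have hd : 0 < d + 1 := Nat.succ_pos d
  have hL : 1 ≤ ℓ + 1 := Nat.succ_pos ℓ
  -- depths: `x` is deeper than `ρL ≥ 4s + (d+1)ℓ`
  have hs4z : 4 * (s : ℤ) + (d + 1 : ℕ) * (ℓ : ℤ) ≤ (c.ρ : ℤ) * (ℓ + 1 : ℕ) := by exact_mod_cast hs4
  have hdx : (c.ρ : ℤ) * (ℓ + 1 : ℕ) + 1 ≤ depth hd (ℓ + 1) c.a c.M c.ρ c.k 1 x := by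
    have h := depth_ge_of_mem_inner hd c.a c.M c.ρ (show 1 < 2 by norm_num) hk2 hx2 (L := ℓ + 1)
    simpa using h
  have hcutx : cutAt hd (ℓ + 1) c.a c.M c.ρ c.k s x = 1 ∧ cutBt hd (ℓ + 1) c.a c.M c.ρ c.k s x = 0 :=
    ⟨(cutAt_eq_of_depth hd (ℓ + 1) c.a c.M c.ρ c.k hs x).1 (by push_cast at hs4z hdx ⊢; nlinarith),
     (cutBt_facts hd (ℓ + 1) c.a c.M c.ρ c.k hs x).2.2.1 (by push_cast at hs4z hdx ⊢; nlinarith)⟩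
  -- a site at depth `≥ 4s` has the same cutoff values, so the integrand vanishes there
  have hcz : ∀ z, 4 * (s : ℤ) ≤ depth hd (ℓ + 1) c.a c.M c.ρ c.k 1 z →
      (cutAt hd (ℓ + 1) c.a c.M c.ρ c.k s z - cutAt hd (ℓ + 1) c.a c.M c.ρ c.k s x) * (η ^ 2 * gAx z)
        + (cutBt hd (ℓ + 1) c.a c.M c.ρ c.k s z - cutBt hd (ℓ + 1) c.a c.M c.ρ c.k s x) * gBx z = 0 := by
    intro z hz
    have h1 : cutAt hd (ℓ + 1) c.a c.M c.ρ c.k s z = 1 := (cutAt_eq_of_depth hd (ℓ + 1) c.a c.M c.ρ c.k hs z).1 (by linarith)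
    have h3 : cutBt hd (ℓ + 1) c.a c.M c.ρ c.k s z = 0 := (cutBt_facts hd (ℓ + 1) c.a c.M c.ρ c.k hs z).2.2.1 hz
    rw [h1, h3, hcutx.1, hcutx.2, sub_self, sub_self, zero_mul, zero_mul, add_zero]
  -- an entry `K(x,z) ≠ 0` forces `z` to be the site, a neighbour, or a tower-block mate
  have hKzero : ∀ z, z ≠ x → (∀ μ : Fin (d + 1), z ≠ x + e μ ∧ z ≠ x - e μ) →
      (∀ j', j' ≤ c.k → blockMap ((ℓ + 1) ^ j') x ∈ c.lamS j' → blockMap ((ℓ + 1) ^ j') z ≠ blockMap ((ℓ + 1) ^ j') x) →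
      K x z = 0 := by
    intro z h1 h2 h3
    rw [hK]
    have hA : ∑ μ : Fin (d + 1), ((2 : ℝ) * (if z = x then (1 : ℝ) else 0) - (if z = x + e μ then (1 : ℝ) else 0)
        - (if z = x - e μ then (1 : ℝ) else 0)) = 0 :=
      Finset.sum_eq_zero fun μ _ => by rw [if_neg h1, if_neg (h2 μ).1, if_neg (h2 μ).2]; ring
    have hB : ∑ j ∈ Finset.range (c.k + 1), (if blockMap ((ℓ + 1) ^ j) x ∈ c.lamS j ∧
        blockMap ((ℓ + 1) ^ j) z = blockMap ((ℓ + 1) ^ j) x then w j * (((((ℓ + 1 : ℕ) : ℝ) ^ (d + 1))⁻¹) ^ j) ^ 2 else 0) = 0 :=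
      Finset.sum_eq_zero fun j hj => by
        rw [if_neg]
        rintro ⟨ht, hb⟩
        exact h3 j (Nat.lt_succ_iff.mp (Finset.mem_range.mp hj)) ht hb
    rw [hA, hB, mul_zero, add_zero]
  -- every `z ∈ S` with `K(x,z) ≠ 0` is at depth `≥ 4s`
  have hdeepz : ∀ z ∈ S, K x z ≠ 0 → 4 * (s : ℤ) ≤ depth hd (ℓ + 1) c.a c.M c.ρ c.k 1 z := by
    intro z hzS hne
    by_contra hlt
    push Not at hlt
    apply hne
    refine hKzero z ?_ ?_ ?_
    · rintro rfl; push_cast at hs4z hdx hlt; nlinarith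
    · intro μ
      have hstep := abs_l1dist_step_le x x μ
      rw [l1dist_self] at hstep
      constructor
      · rintro rfl
        have h := abs_depth_sub_le_l1dist hd (ℓ + 1) c.a c.M c.ρ c.k 1 (x + e μ) x
        have hl : l1dist (x + e μ) x ≤ 1 := by have := hstep.1; rw [sub_zero] at this; exact (le_abs_self _).trans this
        have := (abs_le.mp (h.trans hl)).1
        push_cast at hs4z hdx hlt; nlinarith
      · rintro rfl
        have h := abs_depth_sub_le_l1dist hd (ℓ + 1) c.a c.M c.ρ c.k 1 (x - e μ) x
        have hl : l1dist (x - e μ) x ≤ 1 := by have := hstep.2; rw [sub_zero] at this; exact (le_abs_self _).trans this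
        have := (abs_le.mp (h.trans hl)).1
        push_cast at hs4z hdx hlt; nlinarith
    · intro j' hj'n ht hb
      -- `z` lies in the tower block of `x` at level `j'`
      have hzj' : z ∈ cube (ℓ + 1) c.a c.M c.ρ c.k j' := mem_cube_of_tower c (by rw [hb]; exact ht)
      rcases Nat.lt_or_ge j' 2 with hj'2 | hj'2
      · -- level `≤ 1`: same `L^{j'}`-block, `|z − x|₁ ≤ (d+1)(L^{j'} − 1) ≤ (d+1)ℓ`
        interval_cases j'
        · rw [blockMap_pow_zero, blockMap_pow_zero] at hb
          subst hb
          push_cast at hs4z hdx hlt; nlinarith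
        · rw [pow_one] at hb
          have hl := l1dist_le_of_blockMap_eq hL hb
          have h := abs_depth_sub_le_l1dist hd (ℓ + 1) c.a c.M c.ρ c.k 1 z x
          have := (abs_le.mp (h.trans hl)).1
          push_cast at hs4z hdx hlt this; nlinarith
      · -- level `≥ 2`: `z ∈ □_{j'} ⊆ □₂`, depth `≥ ρL + 1`
        have hz2 : z ∈ cube (ℓ + 1) c.a c.M c.ρ c.k 2 := cube_anti hj'2 hj'n hzj'
        have h := depth_ge_of_mem_inner hd c.a c.M c.ρ (show 1 < 2 by norm_num) hk2 hz2 (L := ℓ + 1)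
        simp only [pow_one] at h
        push_cast at hs4z hlt h; nlinarith
  -- conclusion
  refine Finset.sum_eq_zero fun z hz => ?_
  by_cases hKz : K x z = 0
  · rw [hKz, zero_mul]
  · rw [hcz z (hdeepz z hz hKz), mul_zero]

end Literature.MathematicalPhysics.QuantumFieldTheory.Balaban1983to89.B8Eq1101DentedCubeMemberRegionA4
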